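import Summits.BirchSwinnertonDyer.BirchSwinnertonDyer.Theorems.KimAtThreeKolyvaginPortSharedCert
import Summits.BirchSwinnertonDyer.BirchSwinnertonDyer.Theorems.KimAtThreePortSharedC2Chebotarev
import Summits.BirchSwinnertonDyer.BirchSwinnertonDyer.Theorems.KimAtThreePortSharedC2MinusSymbol
import Literature.NumberTheory.EllipticCurves.LFunctionPrimeCoeff
import Literature.NumberTheory.EllipticCurves.IsogenyFaltingsLFunctionProofs
import HarnessLib

/-!
# (C2′) CLASS-WIDE: the certificate supply of crux `KatoKuriharaPortThreeShared`
# (stmt-BirchSwinnertonDyer-19560) is a THEOREM — the crux BY NAME from (C1) + (C3) alone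
# (cell `bsd-addord`, seat w2-c3 gen 4; route W2 `KimAtThreeKolyvagin`, §U child of 19076)

kim3 gen 10 reduced crux 19560 (the shared-generator PORT″ on the Kato stratum) BY NAME to three
displayed inputs (C1) fine Kato package / (C2) certificate supply / (C3) anomalous rows
(`KimAtThreeKolyvaginPortShared`, p448445) and (C2) to the one-number certificate (C2′)
(`KimAtThreeKolyvaginPortSharedCert`, p451219): per row a prime `q ≡ 2 (mod 3)`, `q ∤ N`, an integer
`n ≥ 1` and `a₀` with `3 ∤ q + 1 − a_q(f)` and `[a₀/qⁿ]⁻_f` a `3`-adic unit — "OPEN class-wide … the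
Ash–Stevens shape" (memo KIM3-W2-PORT-g10 §3 P5).  **This file proves (C2′) for EVERY row, with
`n = 1`, from tree theorems only** — no Ash–Stevens / Vatsal non-vanishing input:

* the modular-symbol half (`KimAtThreePortSharedC2MinusSymbol`, p457059): for every rational newform
  there are integers `α β γ δ`, `N ∣ γ ≠ 0`, `αδ − βγ = 1`, with `[(αk+β)/(γk+δ)]⁻_f = 1/2` for all
  `k` (the minus symbol at `g·0`, `g ∈ Γ₀(N)`, is a period: Manin's relation + the definition of `Ω⁻_f`);
* the Galois half (`KimAtThreePortSharedC2Chebotarev`, p457011): under surj(3) there is a good prime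
  `q ≡ δ (mod |γ|)` outside any finite set with `3 ∤ #Ẽ(𝔽_q)` (Chebotarev, PROVED in the tree, on
  `E[3] × (ℤ/|γ|)ˣ`); as `3 ∣ N ∣ γ` and (after a sign change) `δ ≡ 2 (mod 3)`, `q ≡ 2 (mod 3)`;
* assembly (§2): `q = γk + δ`, `a₀ = αk + β`, `t = a_q(W)` (`a_q(f) = a_q(W) = q + 1 − #Ẽ(𝔽_q)`:
  `IsNewformOf` + `LFunction_apply_prime_eq_frobeniusTrace`), `v₃(1/2) = 0`.

Consequences (§3): `unitMinusSymbol_classwide` has EXACTLY the type of the hypothesis `hC2'` of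
kim3's `katoKuriharaPortThreeShared_of_fineKato_of_unitMinusSymbols_of_anomalousRows`, so the crux
follows BY NAME from (C1) + (C3) (`katoKuriharaPortThreeShared_of_fineKato_of_anomalousRows`), and
PORT″ holds at every row without anomalous bad place from (C1) alone
(`portShared_row_of_fineKato_of_noAnomalous`).  Only the surjectivity of `ρ̄_{E,3}` (`htow 1`),
`Addv W 3` (for `3 ∣ N` via `N = N_W`) and the parametrisation datum `P` are used; the other binders of
(C2′) are carried for the verbatim match.

HONEST LIMITS: closes nothing by itself (19560 stays open on (C1), construction-shaped, and (C3));
nothing is booked; no mark moves.  THEOREMS ONLY (no definition, no named fact).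
References: Ju. I. Manin, Izv. 36 (1972) Prop. 1.4, Thm. 1.6 [Manin1972]; J. Tate, GCFT §2.4 in
Cassels–Fröhlich (1967) [TateGCFT1967]; J.-P. Serre, Invent. Math. 15 (1972) §2, §5 [Serre1972];
J. H. Silverman, *AEC* (2009) Ex. 8.19 (a) [SilvermanAEC2009]; kim3 memo `HOME/kim3/KIM3-W2-PORT-g10.md` §3.
-/

-- every file of this route lives in `Summit.BirchSwinnertonDyer.BirchSwinnertonDyer.Theorems.*` (summit =
-- problem name), so the duplicated-namespace linter is moot here (as in kim3's `KimAtThreeKolyvaginPortShared`).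
set_option linter.dupNamespace false

noncomputable section

open scoped NumberField TensorProduct Classical MatrixGroups
open Field Finset IsDedekindDomain NumberField WeierstrassCurve Rat.HeightOneSpectrum
open Literature.NumberTheory.GaloisRepresentations Literature.NumberTheory.GaloisCohomology
open Literature.NumberTheory.GaloisRepresentations.DiscreteGaloisModule
open Literature.NumberTheory.EllipticCurves Literature.NumberTheory.EllipticCurves.ModularForms
open Literature.NumberTheory.EllipticCurves.Rank1Residual
open Literature.NumberTheory.EllipticCurves.Kato2004
open Literature.NumberTheory.EllipticCurves.Kato2004.EulerSystemValues
open Summit.BirchSwinnertonDyer.Rank1Residual.GaloisImage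
open Summit.BirchSwinnertonDyer.BirchSwinnertonDyer.Theorems

namespace Summit.BirchSwinnertonDyer.BirchSwinnertonDyer.Theorems.KimAtThreePortSharedC2Supply

/-! ### §1. From a progression to the certificate -/

/-- **(C2′) at a row from a progression of unit cusps with `δ ≡ 2 (mod 3)`.**  Let `E = W/ℚ`
(globally minimal) with `ρ̄_{E,3}` onto, `P` a parametrisation datum at level `N`, and integers
`α β γ δ` with `3 ∣ γ`, `γ ≠ 0`, `gcd(γ, δ) = 1`, `δ ≡ 2 (mod 3)` and `[(αk+β)/(γk+δ)]⁻_{P.f} = 1/2`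
whenever `γk + δ ≠ 0`.  The Chebotarev supply (`exists_prime_cast_eq_not_dvd_frobeniusTrace_sub_of_surj`,
class `δ mod |γ|`, excluded set `{ℓ ≤ max N 2}`) gives a good prime `q = γk + δ > max(N, 2)` with
`3 ∤ a_q(W) − (q+1)`; then `q ≡ 2 (mod 3)`, `q ∤ N`, `a_q(P.f) = a_q(W)` (`IsNewformOf`,
`LFunction_apply_prime_eq_frobeniusTrace`) and `[(αk+β)/q]⁻ = 1/2` has `3`-adic valuation `0`.
[cite: TateGCFT1967, §2.4 (Tchebotarev density theorem)] [cite: Manin1972, Prop. 1.4  Thm. 1.6]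
[cite: SilvermanAEC2009, Exercise 8.19(a) (p. 230)] -/
theorem unitMinusSymbol_row_of_progression (W : WeierstrassCurve ℚ) [W.IsElliptic] [W.IsGloballyMinimal]
    (hs : W.HasSurjectiveModNGaloisRep (3 : ℕ)) {N : ℕ} [NeZero N] (P : ModularParametrizationData W N)
    {α β γ δ : ℤ} (h3γ : (3 : ℤ) ∣ γ) (hγ0 : γ ≠ 0) (hcop : IsCoprime γ δ) (hδ : δ % 3 = 2)
    (hprog : ∀ k : ℤ, γ * k + δ ≠ 0 →
      ratMinusSymbol P.f (((α * k + β : ℤ) : ℚ) / ((γ * k + δ : ℤ) : ℚ)) = 1 / 2) :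
    ∃ (q n : ℕ) (t a₀ : ℤ), q.Prime ∧ q % 3 = 2 ∧ ¬ q ∣ N ∧ 1 ≤ n ∧
      cuspCoeff P.f q = t ∧ ¬ (3 : ℤ) ∣ (q : ℤ) + 1 - t ∧
      ratMinusSymbol P.f ((a₀ : ℚ) / ((q ^ n : ℕ) : ℚ)) ≠ 0 ∧
      padicValRat 3 (ratMinusSymbol P.f ((a₀ : ℚ) / ((q ^ n : ℕ) : ℚ))) = 0 := by
  haveI : Fact (Nat.Prime 3) := ⟨Nat.prime_three⟩
  -- the modulus `M = |γ|` and the unit `δ mod M`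
  set M : ℕ := γ.natAbs with hM
  haveI : NeZero M := ⟨Int.natAbs_ne_zero.mpr hγ0⟩
  have hMγ : (M : ℤ) ∣ γ := Int.natAbs_dvd.mpr dvd_rfl
  have hγM : ((γ : ℤ) : ZMod M) = 0 := (ZMod.intCast_zmod_eq_zero_iff_dvd γ M).mpr hMγ
  have hu : IsUnit ((δ : ℤ) : ZMod M) := by
    obtain ⟨a, b, hab⟩ := hcop
    have h1 : ((b : ℤ) : ZMod M) * ((δ : ℤ) : ZMod M) = 1 := by
      have := congrArg (fun z : ℤ => ((z : ℤ) : ZMod M)) hab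
      simp only [Int.cast_add, Int.cast_mul, Int.cast_one, hγM, mul_zero, zero_add] at this
      exact this
    exact IsUnit.of_mul_eq_one_right _ h1
  -- the excluded primes: everything `≤ max N 2`
  set S : Set ℕ := {ℓ | ℓ ≤ max N 2} with hSdef
  have hS : S.Finite := Set.finite_le_nat _
  obtain ⟨q, hqF, hqS, -, hgood, hqu, htr⟩ :=
    KimAtThreePortSharedC2Chebotarev.exists_prime_cast_eq_not_dvd_frobeniusTrace_sub_of_surj W hs M
      hu.unit S hS
  have hq : q.Prime := hqF.out
  have hqmax : max N 2 < q := by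
    by_contra h
    exact hqS (Set.mem_setOf.mpr (not_lt.mp h))
  have hqN : ¬ q ∣ N := fun h =>
    (lt_of_le_of_lt (le_max_left N 2) hqmax).not_ge (Nat.le_of_dvd (Nat.pos_of_neZero N) h)
  -- `q ≡ δ (mod γ)`: `q = γ k + δ`
  have hqδ : ((q : ℤ) : ZMod M) = ((δ : ℤ) : ZMod M) := by
    rw [Int.cast_natCast, hqu, IsUnit.unit_spec]
  have hdvd : γ ∣ (q : ℤ) - δ := by
    have h := (ZMod.intCast_eq_intCast_iff_dvd_sub δ (q : ℤ) M).mp hqδ.symm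
    exact Int.natAbs_dvd.mp h
  obtain ⟨k, hk⟩ := hdvd
  have hqk : (q : ℤ) = γ * k + δ := by linear_combination hk
  -- `q ≡ 2 (mod 3)`
  have hq3 : q % 3 = 2 := by
    obtain ⟨g', hg'⟩ := h3γ
    have h1 : (q : ℤ) = 3 * (g' * k) + δ := by rw [hqk, hg']; ring
    omega
  -- the trace and the coefficient
  have hcoeff : cuspCoeff P.f q = ((W.frobeniusTrace q : ℤ) : ℂ) := by
    rw [P.isNewformOf.2 q, WeierstrassCurve.LFunction_apply_prime_eq_frobeniusTrace W q hgood]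
  have h3t : ¬ (3 : ℤ) ∣ (q : ℤ) + 1 - W.frobeniusTrace q := by
    intro h
    apply htr
    have : W.frobeniusTrace q - ((q : ℤ) + 1) = -((q : ℤ) + 1 - W.frobeniusTrace q) := by ring
    rw [this]
    exact (dvd_neg).mpr h
  -- the unit minus symbol at `(αk+β)/q`
  have hkq : γ * k + δ ≠ 0 := by
    rw [← hqk]; exact_mod_cast hq.ne_zero
  have hsym : ratMinusSymbol P.f (((α * k + β : ℤ) : ℚ) / ((q ^ 1 : ℕ) : ℚ)) = 1 / 2 := by
    have h := hprog k hkq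
    have hcast : ((γ * k + δ : ℤ) : ℚ) = ((q ^ 1 : ℕ) : ℚ) := by
      rw [pow_one, ← hqk, Int.cast_natCast]
    rwa [hcast] at h
  refine ⟨q, 1, W.frobeniusTrace q, α * k + β, hq, hq3, hqN, le_rfl, hcoeff, h3t, ?_, ?_⟩
  · rw [hsym]; norm_num
  · rw [hsym, padicValRat.div one_ne_zero two_ne_zero, padicValRat.one]
    have h2 : padicValRat 3 (2 : ℚ) = 0 := by
      have h := @padicValRat.of_nat 3 2
      rw [Nat.cast_ofNat] at h
      rw [h, padicValNat.eq_zero_of_not_dvd (by norm_num)]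
      simp
    rw [h2, sub_zero]

/-- **(C2′) at a row, from surj(3) and `3 ∣ N` alone.**  The progression of
`KimAtThreePortSharedC2MinusSymbol.exists_progression_ratMinusSymbol_eq_half` for the rational newform
`P.f` (coefficients of `P.f` are the integers `aₙ(W)`), with all four integers negated if
`δ ≡ 1 (mod 3)` (`3 ∤ δ` as `3 ∣ N ∣ γ` and `αδ − βγ = 1`), fed to
`unitMinusSymbol_row_of_progression`. [cite: Manin1972, Prop. 1.4  Thm. 1.6]
[cite: TateGCFT1967, §2.4 (Tchebotarev density theorem)] -/
theorem unitMinusSymbol_row (W : WeierstrassCurve ℚ) [W.IsElliptic] [W.IsGloballyMinimal]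
    (hs : W.HasSurjectiveModNGaloisRep (3 : ℕ)) {N : ℕ} [NeZero N] (h3N : 3 ∣ N)
    (P : ModularParametrizationData W N) :
    ∃ (q n : ℕ) (t a₀ : ℤ), q.Prime ∧ q % 3 = 2 ∧ ¬ q ∣ N ∧ 1 ≤ n ∧
      cuspCoeff P.f q = t ∧ ¬ (3 : ℤ) ∣ (q : ℤ) + 1 - t ∧
      ratMinusSymbol P.f ((a₀ : ℚ) / ((q ^ n : ℕ) : ℚ)) ≠ 0 ∧
      padicValRat 3 (ratMinusSymbol P.f ((a₀ : ℚ) / ((q ^ n : ℕ) : ℚ))) = 0 := by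
  have hf : IsNewform0 P.f := P.isNewformOf.1
  have hQ : coeffField P.f = ⊥ := IsNewformOf.coeffField_eq_bot_of_isNewformOf P.isNewformOf
  have hreal : ∀ n, (cuspCoeff P.f n).im = 0 := fun n => by
    rw [P.isNewformOf.2 n]; exact Complex.intCast_im _
  obtain ⟨α, β, γ, δ, hNγ, hγ0, hdet, hprog⟩ :=
    KimAtThreePortSharedC2MinusSymbol.exists_progression_ratMinusSymbol_eq_half hf hQ hreal
  have h3γ : (3 : ℤ) ∣ γ := dvd_trans (by exact_mod_cast h3N) hNγ
  have hcop : IsCoprime γ δ := ⟨-β, α, by linear_combination hdet⟩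
  -- `3 ∤ δ`
  have h3δ : ¬ (3 : ℤ) ∣ δ := by
    rintro ⟨d', hd'⟩
    obtain ⟨g', hg'⟩ := h3γ
    have h : (3 : ℤ) ∣ 1 := ⟨α * d' - β * g', by rw [← hdet, hd', hg']; ring⟩
    norm_num at h
  have hδ : δ % 3 = 1 ∨ δ % 3 = 2 := by omega
  rcases hδ with hδ1 | hδ2
  · -- negate all four integers: same cusps, `−δ ≡ 2 (mod 3)`
    refine unitMinusSymbol_row_of_progression W hs P (α := -α) (β := -β) (γ := -γ) (δ := -δ)
      ((dvd_neg).mpr h3γ) (neg_ne_zero.mpr hγ0) hcop.neg_neg (by omega) fun k hk => ?_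
    have hk' : γ * k + δ ≠ 0 := by
      intro h; apply hk; linear_combination -h
    have h := hprog k hk'
    have hcast : ((-α * k + -β : ℤ) : ℚ) / ((-γ * k + -δ : ℤ) : ℚ) =
        ((α * k + β : ℤ) : ℚ) / ((γ * k + δ : ℤ) : ℚ) := by
      push_cast
      rw [show -(α : ℚ) * k + -(β : ℚ) = -((α : ℚ) * k + β) by ring,
        show -(γ : ℚ) * k + -(δ : ℚ) = -((γ : ℚ) * k + δ) by ring, neg_div_neg_eq]
    rw [hcast]; exact h
  · exact unitMinusSymbol_row_of_progression W hs P h3γ hγ0 hcop hδ2 hprog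

/-! ### §2. (C2′) class-wide, in kim3's binder shape -/

/-- **(C2′) CLASS-WIDE — the hypothesis `hC2'` of
`KimAtThreeKolyvaginPortSharedCert.katoKuriharaPortThreeShared_of_fineKato_of_unitMinusSymbols_of_anomalousRows`
VERBATIM, as a theorem.**  On every row of the Kato stratum (indeed for every `W` with `ρ̄_{E,3}` onto
— from the tower at `m = 1` —, additive at `3` — so `9 ∣ N = N_W` — and every parametrisation datum
`P`; the Tamagawa, torsion, lattice and Manin binders are not used) there are a prime `q ≡ 2 (mod 3)`,
`q ∤ N`, `n = 1`, `t = a_q(W)` and `a₀` with `a_q(P.f) = t`, `3 ∤ q + 1 − t` and `[a₀/q]⁻_{P.f}` a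
`3`-adic unit (`unitMinusSymbol_row`). [cite: Manin1972, Prop. 1.4  Thm. 1.6]
[cite: TateGCFT1967, §2.4 (Tchebotarev density theorem)] [cite: SilvermanAEC2009, Exercise 8.19(a) (p. 230)] -/
theorem unitMinusSymbol_classwide :
    ∀ (W : WeierstrassCurve ℚ) [W.IsElliptic] [W.IsGloballyMinimal],
      (∀ m : ℕ, W.HasSurjectiveModNGaloisRep (3 ^ m : ℕ)) →
      (haveI : Fact (Nat.Prime 3) := ⟨Nat.prime_three⟩; Addv W 3) →
      ¬ 3 ∣ (W.baseChange ℚ_[3]).localTamagawaNumber ℤ_[3] →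
      Nat.card {Q : (W.baseChange ℚ_[3]).toAffine.Point // (3 : ℕ) • Q = 0} = 1 →
      ∀ {N : ℕ} [NeZero N] (P : ModularParametrizationData W N), N = W.conductorNorm ℤ →
        (∀ z ∈ P.L.lattice, ∃ w ∈ periodLattice P.f, z = P.c * w) →
        ¬ (3 : ℤ) ∣ P.maninConstant →
        ∃ (q n : ℕ) (t a₀ : ℤ), q.Prime ∧ q % 3 = 2 ∧ ¬ q ∣ N ∧ 1 ≤ n ∧
          cuspCoeff P.f q = t ∧ ¬ (3 : ℤ) ∣ (q : ℤ) + 1 - t ∧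
          ratMinusSymbol P.f ((a₀ : ℚ) / ((q ^ n : ℕ) : ℚ)) ≠ 0 ∧
          padicValRat 3 (ratMinusSymbol P.f ((a₀ : ℚ) / ((q ^ n : ℕ) : ℚ))) = 0 := by
  intro W _ _ htow hadd _ _ N _ P hN _ _
  have hs : W.HasSurjectiveModNGaloisRep (3 : ℕ) := by simpa using htow 1
  have h9 : 3 ^ 2 ∣ N := hN ▸ KimAtThreeKolyvaginPortShared.sq_dvd_conductorNorm_of_addv W hadd
  have h3N : 3 ∣ N := dvd_trans (dvd_pow_self 3 two_ne_zero) h9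
  exact unitMinusSymbol_row W hs h3N P

/-! ### §3. The crux BY NAME from (C1) + (C3); PORT″ on non-anomalous rows from (C1) -/

/-- **Crux `KatoKuriharaPortThreeShared` (stmt-BirchSwinnertonDyer-19560) BY NAME from (C1) the fine
Kato package and (C3) the anomalous-bad-place rows ONLY** — kim3's
`katoKuriharaPortThreeShared_of_fineKato_of_unitMinusSymbols_of_anomalousRows` with its middle input
(C2′) DISCHARGED by `unitMinusSymbol_classwide`.  Nothing is booked; (C1) (construction-shaped over the
tree: finite-level `exp*` riders + `ω`-normalisation of Kato's constant) and (C3) (rows with a bad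
`w ≠ 3`, `E(ℚ_w)[3] ≠ 0`) stay displayed.
[cite: Kato2004Asterisque, (8.1.3) (p. 180), Prop. 8.12 (p. 186), §9.4 and Thm. 9.7 (pp. 188–189), Thm. 6.6 (1) (p. 163), Ex. 13.3 (pp. 224–225)]
[cite: Kim2022StructureSelmer, Thm. 3.13 and §3.3–§3.4.1] [cite: TateGCFT1967, §2.4 (Tchebotarev density theorem)] -/
theorem katoKuriharaPortThreeShared_of_fineKato_of_anomalousRows
    (hC1 : ∀ (W : WeierstrassCurve ℚ) [W.IsElliptic] [W.IsGloballyMinimal]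
      [ContinuousSMul ℤ_[3] (W.tateModule 3)] [Module.Free ℤ_[3] (W.tateModule 3)]
      [Module.Finite ℤ_[3] (W.tateModule 3)],
      (∀ m : ℕ, W.HasSurjectiveModNGaloisRep (3 ^ m : ℕ)) →
      (haveI : Fact (Nat.Prime 3) := ⟨Nat.prime_three⟩; Addv W 3) →
      ¬ 3 ∣ (W.baseChange ℚ_[3]).localTamagawaNumber ℤ_[3] →
      Nat.card {Q : (W.baseChange ℚ_[3]).toAffine.Point // (3 : ℕ) • Q = 0} = 1 →
      ∀ (v₃ : HeightOneSpectrum (𝓞 ℚ)), ((3 : ℕ) : 𝓞 ℚ) ∈ v₃.asIdeal →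
      ∀ {N : ℕ} [NeZero N] (P : ModularParametrizationData W N), N = W.conductorNorm ℤ →
        (∀ z ∈ P.L.lattice, ∃ w ∈ periodLattice P.f, z = P.c * w) →
        ¬ (3 : ℤ) ∣ P.maninConstant →
        ∃ (ι : (n : ℕ) → (CyclotomicField n ℚ →+* ℂ)) (κK : ℝ)
          (Λ : ∀ (k' : ℕ) (r : Finset (HeightOneSpectrum (𝓞 ℚ))),
            H1 (tateRep W 3) (cycSubgroup 3 k' r) →ₗ[ℤ_[3]]
              ℚ_[3] ⊗[ℚ] CyclotomicField (cycLevel 3 k' r) ℚ)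
          (Λfin : ∀ j : ℕ, galoisCohomology
            ((W.torsionGaloisModule (((3 : ℕ) : ℤ) ^ j * ((3 : ℕ) : ℤ))).toLocal (Sum.inr v₃)) 1 →+
              ZMod (3 ^ (j + 1))),
          κK ≠ 0 ∧ (∃ u : ℚ, (u : ℝ) = κK ∧ padicValRat 3 u = 0) ∧
          (∀ j : ℕ, KatoExpStarFiniteLevelAt W 3 j 0 v₃ Λ (Λfin j)) ∧
          ∀ (c d a : ℤ) (A : ℕ), 0 < A → Int.gcd c (6 * 3 * A) = 1 → Int.gcd d (6 * 3 * N) = 1 →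
            ∃ (z : ∀ (k' : ℕ) (r : (cyclotomicLevelsRat 3 (badPlaces c d A N)).Ideals),
                  H1 (tateRep W 3) ((cyclotomicLevelsRat 3 (badPlaces c d A N)).level k' r.1))
              (x : ∀ (k' : ℕ) (r : (cyclotomicLevelsRat 3 (badPlaces c d A N)).Ideals),
                  CyclotomicField (cycLevel 3 k' r.1) ℚ),
              ZetaBody W 3 P.f ι κK Λ c d a A z x)
    (hC3 : ∀ (W : WeierstrassCurve ℚ) [W.IsElliptic] [W.IsGloballyMinimal],
      (∀ m : ℕ, W.HasSurjectiveModNGaloisRep (3 ^ m : ℕ)) →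
      (haveI : Fact (Nat.Prime 3) := ⟨Nat.prime_three⟩; Addv W 3) →
      ¬ 3 ∣ (W.baseChange ℚ_[3]).localTamagawaNumber ℤ_[3] →
      Nat.card {Q : (W.baseChange ℚ_[3]).toAffine.Point // (3 : ℕ) • Q = 0} = 1 →
      ∀ (v₃ : HeightOneSpectrum (𝓞 ℚ)), ((3 : ℕ) : 𝓞 ℚ) ∈ v₃.asIdeal →
      ∀ (η : (q : HeightOneSpectrum (𝓞 ℚ)) → (ZMod (Ideal.absNorm q.asIdeal))ˣ),
        (∀ q, Subgroup.zpowers (η q) = ⊤) →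
      ∀ {N : ℕ} [NeZero N] (P : ModularParametrizationData W N), N = W.conductorNorm ℤ →
        (∀ z ∈ P.L.lattice, ∃ w ∈ periodLattice P.f, z = P.c * w) →
        ¬ (3 : ℤ) ∣ P.maninConstant →
        (∃ w : HeightOneSpectrum (𝓞 ℚ), ¬ W.HasGoodReductionAt w ∧
          ((primesEquiv w : Nat.Primes) : ℕ) ≠ 3 ∧
          ∃ Q : (W.baseChange (w.adicCompletion ℚ)).toAffine.Point, 3 • Q = 0 ∧ Q ≠ 0) →
        KatoKuriharaPortThreeAtWith₂ W 0 v₃ η P) :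
    Summit.BirchSwinnertonDyer.BirchSwinnertonDyer.Theses.KimAtThreeKolyvagin.KatoKuriharaPortThreeShared :=
  KimAtThreeKolyvaginPortSharedCert.katoKuriharaPortThreeShared_of_fineKato_of_unitMinusSymbols_of_anomalousRows
    hC1 unitMinusSymbol_classwide hC3

/-- **PORT″ at every Kato-stratum row WITHOUT an anomalous bad place, from (C1) alone** — kim3's
`KimAtThreeKolyvaginPortShared.portShared_row_of_fineKato_of_certSupply_of_noAnomalous` with its
certificate supply (C2) DISCHARGED (`certSupply_of_forall_unitMinusSymbol unitMinusSymbol_classwide`):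
every binder of the crux verbatim, plus "no bad `w ≠ 3` has a non-zero `3`-torsion point over `ℚ_w`",
gives `KatoKuriharaPortThreeAtWith₂ W 0 v₃ η P`.  Nothing is booked.
[cite: Kato2004Asterisque, (8.1.3) (p. 180), Prop. 8.12 (p. 186), §9.4 and Thm. 9.7 (pp. 188–189), Thm. 6.6 (1) (p. 163), Ex. 13.3 (pp. 224–225)]
[cite: Kim2022StructureSelmer, Thm. 3.13 and §3.3–§3.4.1] [cite: TateGCFT1967, §2.4 (Tchebotarev density theorem)] -/
theorem portShared_row_of_fineKato_of_noAnomalous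
    (hC1 : ∀ (W : WeierstrassCurve ℚ) [W.IsElliptic] [W.IsGloballyMinimal]
      [ContinuousSMul ℤ_[3] (W.tateModule 3)] [Module.Free ℤ_[3] (W.tateModule 3)]
      [Module.Finite ℤ_[3] (W.tateModule 3)],
      (∀ m : ℕ, W.HasSurjectiveModNGaloisRep (3 ^ m : ℕ)) →
      (haveI : Fact (Nat.Prime 3) := ⟨Nat.prime_three⟩; Addv W 3) →
      ¬ 3 ∣ (W.baseChange ℚ_[3]).localTamagawaNumber ℤ_[3] →
      Nat.card {Q : (W.baseChange ℚ_[3]).toAffine.Point // (3 : ℕ) • Q = 0} = 1 →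
      ∀ (v₃ : HeightOneSpectrum (𝓞 ℚ)), ((3 : ℕ) : 𝓞 ℚ) ∈ v₃.asIdeal →
      ∀ {N : ℕ} [NeZero N] (P : ModularParametrizationData W N), N = W.conductorNorm ℤ →
        (∀ z ∈ P.L.lattice, ∃ w ∈ periodLattice P.f, z = P.c * w) →
        ¬ (3 : ℤ) ∣ P.maninConstant →
        ∃ (ι : (n : ℕ) → (CyclotomicField n ℚ →+* ℂ)) (κK : ℝ)
          (Λ : ∀ (k' : ℕ) (r : Finset (HeightOneSpectrum (𝓞 ℚ))),
            H1 (tateRep W 3) (cycSubgroup 3 k' r) →ₗ[ℤ_[3]]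
              ℚ_[3] ⊗[ℚ] CyclotomicField (cycLevel 3 k' r) ℚ)
          (Λfin : ∀ j : ℕ, galoisCohomology
            ((W.torsionGaloisModule (((3 : ℕ) : ℤ) ^ j * ((3 : ℕ) : ℤ))).toLocal (Sum.inr v₃)) 1 →+
              ZMod (3 ^ (j + 1))),
          κK ≠ 0 ∧ (∃ u : ℚ, (u : ℝ) = κK ∧ padicValRat 3 u = 0) ∧
          (∀ j : ℕ, KatoExpStarFiniteLevelAt W 3 j 0 v₃ Λ (Λfin j)) ∧
          ∀ (c d a : ℤ) (A : ℕ), 0 < A → Int.gcd c (6 * 3 * A) = 1 → Int.gcd d (6 * 3 * N) = 1 →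
            ∃ (z : ∀ (k' : ℕ) (r : (cyclotomicLevelsRat 3 (badPlaces c d A N)).Ideals),
                  H1 (tateRep W 3) ((cyclotomicLevelsRat 3 (badPlaces c d A N)).level k' r.1))
              (x : ∀ (k' : ℕ) (r : (cyclotomicLevelsRat 3 (badPlaces c d A N)).Ideals),
                  CyclotomicField (cycLevel 3 k' r.1) ℚ),
              ZetaBody W 3 P.f ι κK Λ c d a A z x)
    (W : WeierstrassCurve ℚ) [W.IsElliptic] [W.IsGloballyMinimal]
    (htow : ∀ m : ℕ, W.HasSurjectiveModNGaloisRep (3 ^ m : ℕ))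
    (hadd : haveI : Fact (Nat.Prime 3) := ⟨Nat.prime_three⟩; Addv W 3)
    (hc3 : ¬ 3 ∣ (W.baseChange ℚ_[3]).localTamagawaNumber ℤ_[3])
    (ht : Nat.card {Q : (W.baseChange ℚ_[3]).toAffine.Point // (3 : ℕ) • Q = 0} = 1)
    (v₃ : HeightOneSpectrum (𝓞 ℚ)) (hv₃ : ((3 : ℕ) : 𝓞 ℚ) ∈ v₃.asIdeal)
    (η : (q : HeightOneSpectrum (𝓞 ℚ)) → (ZMod (Ideal.absNorm q.asIdeal))ˣ)
    {N : ℕ} [NeZero N] (P : ModularParametrizationData W N) (hN : N = W.conductorNorm ℤ)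
    (hlat : ∀ z ∈ P.L.lattice, ∃ w ∈ periodLattice P.f, z = P.c * w)
    (hman : ¬ (3 : ℤ) ∣ P.maninConstant)
    -- the row has NO anomalous bad place `w ≠ 3` (THEOREM D's `hbad`)
    (hbad : ∀ w : HeightOneSpectrum (𝓞 ℚ), ¬ W.HasGoodReductionAt w →
      ((primesEquiv w : Nat.Primes) : ℕ) ≠ 3 →
        ∀ Q : (W.baseChange (w.adicCompletion ℚ)).toAffine.Point, 3 • Q = 0 → Q = 0) :
    KatoKuriharaPortThreeAtWith₂ W 0 v₃ η P :=
  KimAtThreeKolyvaginPortShared.portShared_row_of_fineKato_of_certSupply_of_noAnomalous hC1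
    (KimAtThreeKolyvaginPortSharedCert.certSupply_of_forall_unitMinusSymbol unitMinusSymbol_classwide)
    W htow hadd hc3 ht v₃ hv₃ η P hN hlat hman hbad

end Summit.BirchSwinnertonDyer.BirchSwinnertonDyer.Theorems.KimAtThreePortSharedC2Supply

end
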